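import Literature.NumberTheory.ComplexMultiplication.NonGaloisStabilizer
import Literature.AlgebraicGeometry.Pohlmann1968.NondegenerateCMTypeDivisorClasses
import Mathlib.NumberTheory.NumberField.CMField
import HarnessLib

/-!
# The frame of a non-Galois sextic CM field `K ⊇ k`: `Aut(ℂ)` realises every permutation of the three extensions of
# an embedding of `k`, and `Hom(K, ℂ) ≃ ℤ/3 × Bool`

COR-CM (cell `pub-hodgecm2`), seat b30 gen 14 (2026-08-21); count-neutral; theorems only, no definition, no named fact,
no `sorry`.  Second step of the derivation of the FRAME hypotheses of `CorCM/DihedralSexticPairHodgeOfMarkman.lean`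
(the Hodge conjecture for `B₀ × B₁` modulo Markman) from «`K` is not Galois over `ℚ`».

SETTING.  `K` a CM field with `[K:ℚ] = 6`, `k` a CM field, `i : k → K`, `τ : k → ℂ` (so `τ̄ ≠ τ` and every `s : K → ℂ`
restricts along `i` to `τ` or `τ̄`), and an injective enumeration `t : ℤ/3 → Hom(K, ℂ)` of embeddings extending `τ`
(`t p ∘ i = τ`).

* §1 `perm_subsets_closure` — kernel lemma: a subset of `S₃ = Perm(ℤ/3)` containing `1`, closed under products,
  transitive, and containing a non-trivial element with a fixed point, is all of `S₃` (decide).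
* §2 `exists_ringEquiv_forall_comp_eq_perm` — **if `K/ℚ` is not Galois, every permutation `π` of `ℤ/3` is realised:
  `σ ∘ t p = t (π p)` for some `σ ∈ Aut(ℂ)`** (the realised permutations contain `1`, are closed under composition,
  are transitive because `Aut(ℂ)` is transitive on `Hom(K, ℂ)` (tree: `Pohlmann1968.isPretransitive_ringEquiv_complex`),
  and contain a transposition: the automorphism of `NonGaloisField.exists_ringEquiv_comp_eq_and_comp_ne` fixing one
  embedding and moving another fixes `τ`, hence permutes the `τ`-fibre with a fixed point, non-trivially — complex
  conjugation commutes with `Aut(ℂ)` on the embeddings of a CM field).  [cite: Lang2002, VI §1 (Galois group of a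
  composite; `Gal(k F₀^{gal}/ℚ) = S₃ × C₂`)] [cite: Shimura1998, §18.2 Lemma (i)]
* §3 `exists_frame` — the FRAME: a bijection `e : Hom(K, ℂ) ≃ ℤ/3 × Bool` with `e (t p) = (p, true)`,
  `e ((t p)‾) = (p, false)` (every embedding is a `t p` or a `(t p)‾`), `e (s̄) = (place, ¬sign)`, `sign s ↔ s ∘ i = τ`, and the six sign-preserving permutations `(p, b) ↦ (±p + j, b)`
  realised by automorphisms of `ℂ` — exactly the hypotheses `he_conj`, `he_sign`, `he_gal` of
  `DihedralSexticPair.hodgeConjectureFor_biproduct_of_frame_of_markman`.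

## References
* [Lang2002] S. Lang, *Algebra*, 3rd ed., V §3, VI §1 Thm. 1.14.
* [Shimura1998] G. Shimura, *Abelian Varieties with Complex Multiplication and Modular Functions* (1998), §18.2 Lemma (i).

Provenance: Literature home (namespace `Literature.AlgebraicGeometry.ComplexMultiplication.NonGaloisField`) of the Summits-side `CorCM/NonGaloisSexticCMFrame` (cell `pub-hodgecm2`, COR-CM; all its imports are `Literature/`, Mathlib and the already re-homed `NonGaloisStabilizer`), which `Literature/` may not import; theorems only, no named fact, no definition. Nothing here bears on `HC_CM`. Lane `lit-hodgefound` (Layer A3: CM types, their Kubota ranks and Galois combinatorics), seat p20.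
-/

noncomputable section

open NumberField

namespace Literature.AlgebraicGeometry.ComplexMultiplication.NonGaloisField

open Literature.NumberTheory.ComplexMultiplication.NonGaloisField

open Literature.AlgebraicGeometry.Pohlmann1968 (conj_smul_eq_conjugate isPretransitive_ringEquiv_complex)
open Literature.NumberTheory.ComplexMultiplication

open scoped Classical

/-! ## §1 Subsets of `S₃` (kernel) -/

set_option maxRecDepth 8000 in
set_option maxHeartbeats 4000000 in
set_option synthInstance.maxSize 4096 in
set_option synthInstance.maxHeartbeats 400000 in
/-- **A transitive submonoid of `S₃` containing a transposition is `S₃`** (here: a subset of `Perm(ℤ/3)` containing `1`,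
closed under products, transitive, with a non-trivial element having a fixed point, is everything). [cite: Shimura1998, §18.2 Lemma (i)] -/
theorem perm_subsets_closure :
    ∀ R : Finset (Equiv.Perm (ZMod 3)), ((1 : Equiv.Perm (ZMod 3)) ∈ R ∧
      (∀ π ∈ R, ∀ π' ∈ R, π' * π ∈ R) ∧ (∀ a b : ZMod 3, ∃ π ∈ R, π a = b) ∧
      (∃ π ∈ R, π ≠ 1 ∧ ∃ a : ZMod 3, π a = a)) → R = Finset.univ := by
  decide +kernel

/-! ## §2 Every permutation of the `τ`-fibre is realised by `Aut(ℂ)` -/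

section Fibre

variable {K : Type} [Field K] [NumberField K] [IsCMField K] {k : Type} [Field k]

/-- For a CM field, `σ ∘ s̄ = (σ ∘ s)‾` on `Hom(K, ℂ)` for every `σ ∈ Aut(ℂ)` (complex conjugation of `K` commutes with
all embeddings). [cite: Shimura1998, §18.2 Lemma (i)] -/
theorem comp_conjugate (σ : ℂ ≃+* ℂ) (s : K →+* ℂ) :
    (σ : ℂ →+* ℂ).comp (ComplexEmbedding.conjugate s) = ComplexEmbedding.conjugate ((σ : ℂ →+* ℂ).comp s) := by
  refine RingHom.ext fun a => ?_
  change σ (starRingEnd ℂ (s a)) = starRingEnd ℂ (σ (s a))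
  rw [← IsCMField.complexEmbedding_complexConj K s a]
  exact IsCMField.complexEmbedding_complexConj K ((σ : ℂ →+* ℂ).comp s) a

omit [NumberField K] [IsCMField K] in
/-- Restriction along `i` commutes with complex conjugation: `s̄ ∘ i = (s ∘ i)‾`. [cite: Shimura1998, §18.2 Lemma (i)] -/
theorem conjugate_comp (s : K →+* ℂ) (i : k →+* K) :
    (ComplexEmbedding.conjugate s).comp i = ComplexEmbedding.conjugate (s.comp i) := rfl

variable {i : k →+* K} {τ : k →+* ℂ}
  (hττ : ComplexEmbedding.conjugate τ ≠ τ)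
  (hdich : ∀ s : K →+* ℂ, s.comp i = τ ∨ s.comp i = ComplexEmbedding.conjugate τ)
  {t : ZMod 3 → (K →+* ℂ)} (ht : Function.Injective t) (hti : ∀ p, (t p).comp i = τ)
  (htcov : ∀ s : K →+* ℂ, s.comp i = τ → ∃ p, s = t p)

omit [NumberField K] [IsCMField K] in
include hττ hdich in
/-- An automorphism of `ℂ` fixing some embedding of `K` fixes `τ` (`Hom(k,ℂ) = {τ, τ̄}`). [cite: Shimura1998, §18.2 Lemma (i)] -/
theorem comp_eq_of_comp_eq_self {σ : ℂ ≃+* ℂ} {s : K →+* ℂ} (hs : (σ : ℂ →+* ℂ).comp s = s) :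
    (σ : ℂ →+* ℂ).comp τ = τ := by
  have key : ∀ s' : K →+* ℂ, (σ : ℂ →+* ℂ).comp s' = s' → s'.comp i = τ → (σ : ℂ →+* ℂ).comp τ = τ := by
    intro s' hs' hi
    rw [← hi, ← RingHom.comp_assoc, hs']
  rcases hdich s with h | h
  · exact key s hs h
  · -- `σ` fixes `τ̄`; it sends `τ` to `τ` or `τ̄`, and the second is impossible
    have hfix : (σ : ℂ →+* ℂ).comp (ComplexEmbedding.conjugate τ) = ComplexEmbedding.conjugate τ := by
      rw [← h, ← RingHom.comp_assoc, hs]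
    -- `σ ∘ τ` is an embedding of `k` through `K`? use the dichotomy on `σ ∘ s̄`... simpler: compare on `K` via `s`
    have h2 : ((σ : ℂ →+* ℂ).comp (ComplexEmbedding.conjugate s)).comp i = τ := by
      rw [RingHom.comp_assoc, conjugate_comp, h, ComplexEmbedding.involutive_conjugate k τ]
      rcases hdich ((σ : ℂ →+* ℂ).comp (ComplexEmbedding.conjugate s)) with h3 | h3
      · rw [RingHom.comp_assoc] at h3
        rw [conjugate_comp, h, ComplexEmbedding.involutive_conjugate k τ] at h3
        exact h3
      · exfalso
        rw [RingHom.comp_assoc, conjugate_comp, h, ComplexEmbedding.involutive_conjugate k τ] at h3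
        -- `σ ∘ τ = τ̄ = σ ∘ τ̄` contradicts injectivity of `σ ∘ -`
        have h4 : τ = ComplexEmbedding.conjugate τ := by
          refine RingHom.ext fun z => σ.injective ?_
          have e3 := RingHom.congr_fun h3 z
          have e4 := RingHom.congr_fun hfix z
          simp only [RingHom.coe_comp, RingHom.coe_coe, Function.comp_apply] at e3 e4
          rw [e3, e4]
        exact hττ h4.symm
    rw [RingHom.comp_assoc, conjugate_comp, h, ComplexEmbedding.involutive_conjugate k τ] at h2
    exact h2

omit [NumberField K] [IsCMField K] in
include ht hti htcov in
/-- An automorphism of `ℂ` fixing `τ` permutes the `τ`-fibre `{t p}`: there is a permutation `π` of `ℤ/3` with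
`σ ∘ t p = t (π p)`. [cite: Shimura1998, §18.2 Lemma (i)] -/
theorem exists_perm_of_comp_eq {σ : ℂ ≃+* ℂ} (hσ : (σ : ℂ →+* ℂ).comp τ = τ) :
    ∃ π : Equiv.Perm (ZMod 3), ∀ p, (σ : ℂ →+* ℂ).comp (t p) = t (π p) := by
  have hmem : ∀ p, ∃ q, (σ : ℂ →+* ℂ).comp (t p) = t q := fun p =>
    htcov _ (by rw [RingHom.comp_assoc, hti, hσ])
  choose f hf using hmem
  have hfinj : Function.Injective f := by
    intro p q hpq
    have h1 : (σ : ℂ →+* ℂ).comp (t p) = (σ : ℂ →+* ℂ).comp (t q) := by rw [hf p, hf q, hpq]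
    exact ht (RingHom.ext fun a => σ.injective (RingHom.congr_fun h1 a))
  exact ⟨Equiv.ofBijective f (Finite.injective_iff_bijective.1 hfinj), fun p => hf p⟩

include hττ hdich ht hti htcov in
/-- **If `K/ℚ` is not Galois, every permutation of the `τ`-fibre is realised by an automorphism of `ℂ`.**
[cite: Lang2002, VI §1 Thm. 1.14] [cite: Shimura1998, §18.2 Lemma (i)] -/
theorem exists_ringEquiv_forall_comp_eq_perm (hK : ¬ IsGalois ℚ K) (π : Equiv.Perm (ZMod 3)) :
    ∃ σ : ℂ ≃+* ℂ, ∀ p, (σ : ℂ →+* ℂ).comp (t p) = t (π p) := by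
  -- the set of realised permutations
  set R : Finset (Equiv.Perm (ZMod 3)) :=
    Finset.univ.filter fun π => ∃ σ : ℂ ≃+* ℂ, ∀ p, (σ : ℂ →+* ℂ).comp (t p) = t (π p) with hR
  have hRmem : ∀ π, π ∈ R ↔ ∃ σ : ℂ ≃+* ℂ, ∀ p, (σ : ℂ →+* ℂ).comp (t p) = t (π p) := fun π => by
    rw [hR, Finset.mem_filter]; simp
  suffices hRU : R = Finset.univ by
    have := (hRmem π).1 (hRU ▸ Finset.mem_univ π)
    exact this
  refine perm_subsets_closure R ⟨?_, ?_, ?_, ?_⟩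
  · -- `1` is realised by the identity
    exact (hRmem 1).2 ⟨RingEquiv.refl ℂ, fun p => RingHom.ext fun _ => rfl⟩
  · -- closed under products
    intro π₁ h₁ π₂ h₂
    obtain ⟨σ₁, hσ₁⟩ := (hRmem π₁).1 h₁
    obtain ⟨σ₂, hσ₂⟩ := (hRmem π₂).1 h₂
    refine (hRmem _).2 ⟨σ₁.trans σ₂, fun p => ?_⟩
    have hc : ((σ₁.trans σ₂ : ℂ ≃+* ℂ) : ℂ →+* ℂ).comp (t p) = (σ₂ : ℂ →+* ℂ).comp ((σ₁ : ℂ →+* ℂ).comp (t p)) :=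
      RingHom.ext fun _ => rfl
    rw [hc, hσ₁, hσ₂, Equiv.Perm.mul_apply]
  · -- transitive: `Aut(ℂ)` is transitive on `Hom(K, ℂ)` and an automorphism moving `t a` to `t b` fixes `τ`
    intro a b
    haveI := isPretransitive_ringEquiv_complex (K := K)
    obtain ⟨σ, hσ⟩ := MulAction.exists_smul_eq (ℂ ≃+* ℂ) (t a) (t b)
    have hσ' : (σ : ℂ →+* ℂ).comp (t a) = t b := hσ
    have hστ : (σ : ℂ →+* ℂ).comp τ = τ := by
      calc (σ : ℂ →+* ℂ).comp τ = (σ : ℂ →+* ℂ).comp ((t a).comp i) := by rw [hti a]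
        _ = ((σ : ℂ →+* ℂ).comp (t a)).comp i := by rw [RingHom.comp_assoc]
        _ = τ := by rw [hσ', hti b]
    obtain ⟨π, hπ⟩ := exists_perm_of_comp_eq ht hti htcov hστ
    refine ⟨π, (hRmem π).2 ⟨σ, hπ⟩, ht ?_⟩
    rw [← hπ a, hσ']
  · -- a transposition: the non-free automorphism of `NonGaloisField.exists_ringEquiv_comp_eq_and_comp_ne`
    obtain ⟨σ, s, hs₀, hs⟩ := exists_ringEquiv_comp_eq_and_comp_ne hK (t 0)
    have hστ : (σ : ℂ →+* ℂ).comp τ = τ := comp_eq_of_comp_eq_self hττ hdich hs₀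
    obtain ⟨π, hπ⟩ := exists_perm_of_comp_eq ht hti htcov hστ
    refine ⟨π, (hRmem π).2 ⟨σ, hπ⟩, ?_, 0, ht (by rw [← hπ 0, hs₀])⟩
    -- `π ≠ 1`: `σ` moves `s`, hence moves the member of the `τ`-fibre among `s, s̄`
    intro hπ1
    apply hs
    rcases hdich s with h | h
    · obtain ⟨p, rfl⟩ := htcov s h
      rw [hπ p, hπ1, Equiv.Perm.one_apply]
    · obtain ⟨p, hp⟩ := htcov (ComplexEmbedding.conjugate s)
        (by rw [conjugate_comp, h, ComplexEmbedding.involutive_conjugate k τ])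
      have h1 : (σ : ℂ →+* ℂ).comp (ComplexEmbedding.conjugate s) = ComplexEmbedding.conjugate s := by
        rw [hp, hπ p, hπ1, Equiv.Perm.one_apply]
      rw [comp_conjugate] at h1
      have h2 := congrArg ComplexEmbedding.conjugate h1
      rwa [ComplexEmbedding.involutive_conjugate K, ComplexEmbedding.involutive_conjugate K] at h2

end Fibre

/-! ## §3 The frame `Hom(K, ℂ) ≃ ℤ/3 × Bool` -/

section Frame

variable {K : Type} [Field K] [NumberField K] [IsCMField K] {k : Type} [Field k]
  {i : k →+* K} {τ : k →+* ℂ}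
  (hττ : ComplexEmbedding.conjugate τ ≠ τ)
  (hdich : ∀ s : K →+* ℂ, s.comp i = τ ∨ s.comp i = ComplexEmbedding.conjugate τ)
  {t : ZMod 3 → (K →+* ℂ)} (ht : Function.Injective t) (hti : ∀ p, (t p).comp i = τ)

omit [IsCMField K] in
include hττ ht hti in
/-- The map `(p, true) ↦ t p`, `(p, false) ↦ (t p)‾` is a bijection `ℤ/3 × Bool ≃ Hom(K, ℂ)` when `[K:ℚ] = 6`. [cite: Shimura1998, §18.2 Lemma (i)] -/
theorem bijective_frameInv (h6 : Module.finrank ℚ K = 6) :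
    Function.Bijective fun y : ZMod 3 × Bool => if y.2 then t y.1 else ComplexEmbedding.conjugate (t y.1) := by
  have hinj : Function.Injective fun y : ZMod 3 × Bool =>
      if y.2 then t y.1 else ComplexEmbedding.conjugate (t y.1) := by
    have hsign : ∀ p, (ComplexEmbedding.conjugate (t p)).comp i ≠ τ := fun p => by
      rw [conjugate_comp, hti]; exact hττ
    rintro ⟨p, b⟩ ⟨p', b'⟩ h
    cases b <;> cases b' <;> simp only [Bool.false_eq_true, ↓reduceIte] at h
    · have := ComplexEmbedding.involutive_conjugate K (t p)
      rw [h, ComplexEmbedding.involutive_conjugate K] at this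
      rw [ht this.symm]
    · exact absurd (hti p') (h ▸ hsign p)
    · exact absurd (hti p) (h.symm ▸ hsign p')
    · rw [ht h]
  refine (Fintype.bijective_iff_injective_and_card _).2 ⟨hinj, ?_⟩
  rw [Fintype.card_prod, ZMod.card, Fintype.card_bool, Embeddings.card, h6]

include hττ hdich ht hti in
/-- **The frame of a non-Galois sextic CM field `K ⊇ i(k)`**: a bijection `e : Hom(K, ℂ) ≃ ℤ/3 × Bool` with
`e (t p) = (p, true)`, complex conjugation flipping the sign and keeping the place, sign `true` iff `s ∘ i = τ`, and the
six sign-preserving permutations `(p, b) ↦ (±p + j, b)` realised by automorphisms of `ℂ` — the hypotheses `he_conj`,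
`he_sign`, `he_gal` of `DihedralSexticPair.hodgeConjectureFor_biproduct_of_frame_of_markman`.
[cite: Lang2002, VI §1 Thm. 1.14] [cite: Shimura1998, §18.2 Lemma (i)] -/
theorem exists_frame (hK : ¬ IsGalois ℚ K) (h6 : Module.finrank ℚ K = 6) :
    ∃ e : (K →+* ℂ) ≃ ZMod 3 × Bool, (∀ p, e (t p) = (p, true)) ∧
      (∀ p, e (ComplexEmbedding.conjugate (t p)) = (p, false)) ∧
      (∀ s, ∃ p, s = t p ∨ s = ComplexEmbedding.conjugate (t p)) ∧
      (∀ s, e (ComplexEmbedding.conjugate s) = ((e s).1, !(e s).2)) ∧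
      (∀ s, s.comp i = τ ↔ (e s).2 = true) ∧
      (∀ (j : ZMod 3) (f : Bool), ∃ σ : ℂ ≃+* ℂ, ∀ s : K →+* ℂ,
        e ((σ : ℂ →+* ℂ).comp s) = ((if f then -(e s).1 else (e s).1) + j, (e s).2)) := by
  set g : ZMod 3 × Bool → (K →+* ℂ) := fun y => if y.2 then t y.1 else ComplexEmbedding.conjugate (t y.1) with hg
  have hgb : Function.Bijective g := bijective_frameInv hττ ht hti h6
  set e : (K →+* ℂ) ≃ ZMod 3 × Bool := (Equiv.ofBijective g hgb).symm with he
  have het : ∀ p, e (t p) = (p, true) := fun p => by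
    rw [he, Equiv.symm_apply_eq, Equiv.ofBijective_apply, hg]
    simp
  have hec : ∀ p, e (ComplexEmbedding.conjugate (t p)) = (p, false) := fun p => by
    rw [he, Equiv.symm_apply_eq, Equiv.ofBijective_apply, hg]
    simp
  -- every embedding is `t p` or `(t p)‾`
  have hcases : ∀ s : K →+* ℂ, ∃ p, s = t p ∨ s = ComplexEmbedding.conjugate (t p) := fun s => by
    obtain ⟨⟨p, b⟩, hb⟩ := hgb.2 s
    refine ⟨p, ?_⟩
    cases b
    · exact Or.inr hb.symm
    · exact Or.inl hb.symm
  have htcov : ∀ s : K →+* ℂ, s.comp i = τ → ∃ p, s = t p := fun s hs => by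
    obtain ⟨p, h | h⟩ := hcases s
    · exact ⟨p, h⟩
    · exfalso
      rw [h, conjugate_comp, hti] at hs
      exact hττ hs
  refine ⟨e, het, hec, hcases, fun s => ?_, fun s => ?_, fun j f => ?_⟩
  · obtain ⟨p, rfl | rfl⟩ := hcases s
    · rw [hec, het]; rfl
    · rw [ComplexEmbedding.involutive_conjugate K, het, hec]; rfl
  · obtain ⟨p, rfl | rfl⟩ := hcases s
    · rw [het]; exact ⟨fun _ => rfl, fun _ => hti p⟩
    · rw [hec, conjugate_comp, hti]
      exact iff_of_false hττ (by simp)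
  · set π : Equiv.Perm (ZMod 3) := (if f then Equiv.neg (ZMod 3) else Equiv.refl (ZMod 3)).trans
      (Equiv.addRight j) with hπ
    have hπp : ∀ p, π p = (if f then -p else p) + j := fun p => by
      rw [hπ]; cases f <;> rfl
    obtain ⟨σ, hσ⟩ := exists_ringEquiv_forall_comp_eq_perm hττ hdich ht hti htcov hK π
    refine ⟨σ, fun s => ?_⟩
    obtain ⟨p, rfl | rfl⟩ := hcases s
    · rw [hσ p, het, het, hπp]
    · rw [comp_conjugate, hσ p, hec, hec, hπp]

end Frame

end Literature.AlgebraicGeometry.ComplexMultiplication.NonGaloisField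

end
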